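import Summits.AtomisticToContinuum.HydrodynamicLimit.Theorems.CollisionIsometryCLTCollisionalTransferLocalityBlockFields
import HarnessLib

/-!
# Pointwise domination of the kinetic integrand `Σ D² + |q|²` by explicit block moments

Registered stub `stub_kineticIntegrand_le_dominators` ([KF-dom]) of the line `hemisphere-affine-slaving`
of the crux `CollisionalTransferLocality` (stmt-AtomisticToContinuum-9518), instance B.

DETERMINISTIC pointwise inequality (no probability): for a nonnegative kernel `φ`, every `θ : ℝ`,
every configuration `z` and every `x ∈ 𝕋³`,

  `Σ_jk D_jk² + |q|² ≤ 2 Σ_jk A_jk² + 4 |m̄|² (Ē/ρ̄) + ½ Σ_a T_a² + 50 |m̄|² (Ē/ρ̄)²`,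

where (finite-sum forms of `…BlockFields`, `φᵢ = φ(xᵢ − x) ≥ 0`, `vᵢ` the velocities)
`A_jk = (N+1)⁻¹ Σᵢ φᵢ (v_{ij} v_{ik} − θ δ_jk)` and `T_a = (N+1)⁻¹ Σᵢ φᵢ |vᵢ|² v_{ia}`.

Proof.
* Empty block (`ρ̄ = 0`): every `φᵢ = 0`, so `D = 0`, `q = 0`, and the right-hand side is `≥ 0`.
* Stress: with `X_jk = (N+1)⁻¹Σᵢφᵢ(v_{ij} − ū_j)(v_{ik} − ū_k)` one has `D = X − (tr X/3)δ`, and removing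
  the trace is a Frobenius contraction, `Σ(X − (trX/3)δ)² ≤ Σ(X − λδ)²` for EVERY scalar `λ`
  (`sum_sq_traceless_le`). With `λ = θρ̄` and `m̄ = ρ̄ū`: `X − θρ̄δ = A − ρ̄ ū ūᵀ`, so
  `ΣD² ≤ 2ΣA² + 2ρ̄²|ū|⁴ ≤ 2ΣA² + 4|m̄|²(Ē/ρ̄)` by `ρ̄|ū|² ≤ 2Ē` (weighted Cauchy–Schwarz,
  `norm_uB_sq_le`).
* Heat flux: expanding `|v − ū|²(v − ū)` and averaging,
  `2q = T − 2Ē ū − 2(N+1)⁻¹Σᵢφᵢ⟪vᵢ,ū⟫vᵢ + 2ρ̄|ū|²ū`, whence `|q| ≤ |T|/2 + 5Ē|ū|` and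
  `|q|² ≤ ½|T|² + 50 Ē²|ū|² = ½ Σ_a T_a² + 50|m̄|²(Ē/ρ̄)²`.
Sources: folklore (Grad's moment bookkeeping; Spohn 1991 I §3 for the block fields).
-/

namespace Summit.AtomisticToContinuum.HydrodynamicLimit.Theorems.HemisphereAffineSlaving

open scoped BigOperators Topology Classical ENNReal InnerProductSpace
open Filter Set Function MeasureTheory

noncomputable section

open Literature.MathematicalPhysics.KineticTheory (T3 V3)

/-! ## Algebraic lemmas on `3 × 3` arrays -/

/-- Removing the trace is a contraction in the Frobenius norm: for every `3 × 3` real array `X`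
and EVERY scalar `l`, `Σ_jk (X_jk − (tr X/3) δ_jk)² ≤ Σ_jk (X_jk − l δ_jk)²` (the difference is
`3 (l − tr X/3)²`). [folklore] -/
private theorem sum_sq_traceless_le (X : Fin 3 → Fin 3 → ℝ) (l : ℝ) :
    ∑ j, ∑ k, (X j k - if j = k then (∑ i, X i i) / 3 else 0) ^ 2 ≤
      ∑ j, ∑ k, (X j k - if j = k then l else 0) ^ 2 := by
  simp only [Fin.sum_univ_three, Fin.isValue, show (0 : Fin 3) ≠ 1 by decide,
    show (0 : Fin 3) ≠ 2 by decide, show (1 : Fin 3) ≠ 0 by decide, show (1 : Fin 3) ≠ 2 by decide,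
    show (2 : Fin 3) ≠ 0 by decide, show (2 : Fin 3) ≠ 1 by decide, if_true, if_false, sub_zero]
  nlinarith [sq_nonneg (l - (X 0 0 + X 1 1 + X 2 2) / 3)]

/-- `Σ_jk (A_jk − r w_j w_k)² ≤ 2 Σ_jk A_jk² + 2 r² (Σ_j w_j²)²`. [folklore] -/
private theorem sum_sq_sub_rank_one_le (A : Fin 3 → Fin 3 → ℝ) (w : Fin 3 → ℝ) (r : ℝ) :
    ∑ j, ∑ k, (A j k - r * (w j * w k)) ^ 2 ≤
      2 * (∑ j, ∑ k, A j k ^ 2) + 2 * (r ^ 2 * (∑ j, w j ^ 2) ^ 2) := by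
  have h : ∀ j k, (A j k - r * (w j * w k)) ^ 2 ≤ 2 * A j k ^ 2 + 2 * (r ^ 2 * (w j ^ 2 * w k ^ 2)) :=
    fun j k => by nlinarith [sq_nonneg (A j k + r * (w j * w k))]
  calc ∑ j, ∑ k, (A j k - r * (w j * w k)) ^ 2
      ≤ ∑ j, ∑ k, (2 * A j k ^ 2 + 2 * (r ^ 2 * (w j ^ 2 * w k ^ 2))) :=
        Finset.sum_le_sum fun j _ => Finset.sum_le_sum fun k _ => h j k
    _ = 2 * (∑ j, ∑ k, A j k ^ 2) + 2 * (r ^ 2 * (∑ j, w j ^ 2) ^ 2) := by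
        simp only [Fin.sum_univ_three]
        ring

/-! ## The two deterministic estimates in finite-sum form -/

section Core

variable {n : ℕ} (c θ ρ E : ℝ) (a : Fin n → ℝ) (v : Fin n → V3) (u : V3)

/-- STRESS. With weights `c aᵢ`, velocities `vᵢ`, a vector `u` and a scalar `ρ` such that
`c Σ aᵢ = ρ` and `c Σ aᵢ vᵢ = ρ u` (block density and `m̄ = ρ̄ ū`): the traceless central second
moment is dominated by the `θ`-shifted raw second moment and `ρ²|u|⁴`, for every `θ`. [folklore] -/
private theorem sum_sq_traceless_central_le (hρ : c * ∑ i, a i = ρ)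
    (hm : ∀ j, c * ∑ i, a i * v i j = ρ * u j) :
    ∑ j, ∑ k, (c * ∑ i, a i * ((v i j - u j) * (v i k - u k)) -
        if j = k then (∑ l, c * ∑ i, a i * (v i l - u l) ^ 2) / 3 else 0) ^ 2 ≤
      2 * (∑ j, ∑ k, (c * ∑ i, a i * (v i j * v i k - if j = k then θ else 0)) ^ 2) +
        2 * (ρ ^ 2 * (‖u‖ ^ 2) ^ 2) := by
  have hdiag : ∀ l, c * ∑ i, a i * (v i l - u l) ^ 2 =
      c * ∑ i, a i * ((v i l - u l) * (v i l - u l)) := fun l => by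
    simp only [sq]
  have hXY : ∀ j k, (c * ∑ i, a i * ((v i j - u j) * (v i k - u k)) - if j = k then θ * ρ else 0) =
      c * ∑ i, a i * (v i j * v i k - if j = k then θ else 0) - ρ * (u j * u k) := by
    intro j k
    have hX1 : c * ∑ i, a i * ((v i j - u j) * (v i k - u k)) =
        c * ∑ i, a i * (v i j * v i k) - u j * (c * ∑ i, a i * v i k) -
          u k * (c * ∑ i, a i * v i j) + u j * u k * (c * ∑ i, a i) := by
      simp only [Finset.mul_sum, ← Finset.sum_sub_distrib, ← Finset.sum_add_distrib]
      exact Finset.sum_congr rfl fun i _ => by ring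
    have hA1 : c * ∑ i, a i * (v i j * v i k - if j = k then θ else 0) =
        c * ∑ i, a i * (v i j * v i k) - (if j = k then θ else 0) * (c * ∑ i, a i) := by
      simp only [Finset.mul_sum, ← Finset.sum_sub_distrib]
      exact Finset.sum_congr rfl fun i _ => by ring
    have hite : (if j = k then θ * ρ else 0) = (if j = k then θ else 0) * ρ := by
      split_ifs <;> ring
    rw [hite]
    linear_combination hX1 - hA1 - u j * hm k - u k * hm j +
      (u j * u k + if j = k then θ else 0) * hρ
  calc ∑ j, ∑ k, (c * ∑ i, a i * ((v i j - u j) * (v i k - u k)) -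
        if j = k then (∑ l, c * ∑ i, a i * (v i l - u l) ^ 2) / 3 else 0) ^ 2
      = ∑ j, ∑ k, (c * ∑ i, a i * ((v i j - u j) * (v i k - u k)) -
          if j = k then (∑ l, c * ∑ i, a i * ((v i l - u l) * (v i l - u l))) / 3 else 0) ^ 2 := by
        simp only [hdiag]
    _ ≤ ∑ j, ∑ k, (c * ∑ i, a i * ((v i j - u j) * (v i k - u k)) -
          if j = k then θ * ρ else 0) ^ 2 :=
        sum_sq_traceless_le (fun j k => c * ∑ i, a i * ((v i j - u j) * (v i k - u k))) (θ * ρ)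
    _ = ∑ j, ∑ k, (c * ∑ i, a i * (v i j * v i k - if j = k then θ else 0) - ρ * (u j * u k)) ^ 2 := by
        simp only [hXY]
    _ ≤ 2 * (∑ j, ∑ k, (c * ∑ i, a i * (v i j * v i k - if j = k then θ else 0)) ^ 2) +
          2 * (ρ ^ 2 * (∑ j, u j ^ 2) ^ 2) :=
        sum_sq_sub_rank_one_le (fun j k => c * ∑ i, a i * (v i j * v i k - if j = k then θ else 0))
          (fun j => u j) ρ
    _ = _ := by rw [← EuclideanSpace.real_norm_sq_eq]

/-- HEAT FLUX. With nonnegative weights `c aᵢ`, velocities `vᵢ`, `u`, `ρ`, `E` such that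
`c Σ aᵢ = ρ`, `c Σ aᵢ |vᵢ|²/2 = E`, `c Σ aᵢ vᵢ = ρ u` and `ρ |u|² ≤ 2E`:
`|c Σ aᵢ (|vᵢ − u|²/2)(vᵢ − u)| ≤ |c Σ aᵢ |vᵢ|² vᵢ| / 2 + 5 E |u|`. [folklore] -/
private theorem norm_heatFlux_le (hc : 0 ≤ c) (ha : ∀ i, 0 ≤ a i) (hρ : c * ∑ i, a i = ρ)
    (hE : c * ∑ i, a i * (‖v i‖ ^ 2 / 2) = E) (hm : ∀ j, c * ∑ i, a i * v i j = ρ * u j)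
    (hK : ρ * ‖u‖ ^ 2 ≤ 2 * E) :
    ‖c • ∑ i, (a i * ‖v i - u‖ ^ 2 / 2) • (v i - u)‖ ≤
      ‖c • ∑ i, a i • (‖v i‖ ^ 2 • v i)‖ / 2 + 5 * E * ‖u‖ := by
  have hE0 : 0 ≤ E :=
    hE ▸ mul_nonneg hc (Finset.sum_nonneg fun i _ => mul_nonneg (ha i) (by positivity))
  have hρ0 : 0 ≤ ρ := hρ ▸ mul_nonneg hc (Finset.sum_nonneg fun i _ => ha i)
  -- `c Σ aᵢ ⟪vᵢ, u⟫ = ⟪ρ u, u⟫ = ρ |u|²`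
  have hmi : c * ∑ i, a i * ⟪v i, u⟫_ℝ = ρ * ‖u‖ ^ 2 := by
    have hvec : c • ∑ i, a i • v i = ρ • u := by
      ext j
      simpa only [PiLp.smul_apply, WithLp.ofLp_sum, Finset.sum_apply, smul_eq_mul] using hm j
    have h := congrArg (fun w : V3 => ⟪w, u⟫_ℝ) hvec
    simpa only [real_inner_smul_left, sum_inner, real_inner_self_eq_norm_sq, Finset.mul_sum]
      using h
  -- the decomposition `2q = T − 2E u − 2P + 2ρ|u|² u`
  have hid : (2 : ℝ) • (c • ∑ i, (a i * ‖v i - u‖ ^ 2 / 2) • (v i - u)) =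
      c • ∑ i, a i • (‖v i‖ ^ 2 • v i) - (2 * E) • u -
        (2 : ℝ) • (c • ∑ i, (a i * ⟪v i, u⟫_ℝ) • v i) + (2 * ρ * ‖u‖ ^ 2) • u := by
    ext j
    simp only [PiLp.smul_apply, PiLp.sub_apply, PiLp.add_apply, WithLp.ofLp_sum, Finset.sum_apply,
      smul_eq_mul, norm_sub_sq_real]
    have hexp : 2 * (c * ∑ i, a i * (‖v i‖ ^ 2 - 2 * ⟪v i, u⟫_ℝ + ‖u‖ ^ 2) / 2 * (v i j - u j)) =
        c * ∑ i, a i * (‖v i‖ ^ 2 * v i j) - u j * (2 * (c * ∑ i, a i * (‖v i‖ ^ 2 / 2))) -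
          2 * (c * ∑ i, a i * ⟪v i, u⟫_ℝ * v i j) + 2 * u j * (c * ∑ i, a i * ⟪v i, u⟫_ℝ) +
          ‖u‖ ^ 2 * (c * ∑ i, a i * v i j) - ‖u‖ ^ 2 * u j * (c * ∑ i, a i) := by
      simp only [Finset.mul_sum, ← Finset.sum_sub_distrib, ← Finset.sum_add_distrib]
      exact Finset.sum_congr rfl fun i _ => by ring
    linear_combination hexp - 2 * u j * hE + 2 * u j * hmi + ‖u‖ ^ 2 * hm j -
      ‖u‖ ^ 2 * u j * hρ
  -- `|P| ≤ 2E|u|`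
  have hP : ‖c • ∑ i, (a i * ⟪v i, u⟫_ℝ) • v i‖ ≤ 2 * E * ‖u‖ := by
    rw [norm_smul, Real.norm_eq_abs, abs_of_nonneg hc]
    calc c * ‖∑ i, (a i * ⟪v i, u⟫_ℝ) • v i‖ ≤ c * ∑ i, a i * (‖v i‖ ^ 2 * ‖u‖) := by
          refine mul_le_mul_of_nonneg_left
            ((norm_sum_le _ _).trans (Finset.sum_le_sum fun i _ => ?_)) hc
          rw [norm_smul, Real.norm_eq_abs, abs_mul, abs_of_nonneg (ha i), mul_assoc]
          refine mul_le_mul_of_nonneg_left ?_ (ha i)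
          calc |⟪v i, u⟫_ℝ| * ‖v i‖ ≤ ‖v i‖ * ‖u‖ * ‖v i‖ :=
                mul_le_mul_of_nonneg_right (abs_real_inner_le_norm _ _) (norm_nonneg _)
            _ = ‖v i‖ ^ 2 * ‖u‖ := by ring
      _ = 2 * E * ‖u‖ := by
          rw [← hE]
          simp only [Finset.mul_sum, Finset.sum_mul]
          exact Finset.sum_congr rfl fun i _ => by ring
  -- triangle inequality on the decomposition
  have h2q : ‖(2 : ℝ) • (c • ∑ i, (a i * ‖v i - u‖ ^ 2 / 2) • (v i - u))‖ ≤
      ‖c • ∑ i, a i • (‖v i‖ ^ 2 • v i)‖ + 2 * E * ‖u‖ + 2 * (2 * E * ‖u‖) + 4 * E * ‖u‖ := by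
    rw [hid]
    refine (norm_add_le _ _).trans (add_le_add ((norm_sub_le _ _).trans (add_le_add
      ((norm_sub_le _ _).trans (add_le_add le_rfl ?_)) ?_)) ?_)
    · rw [norm_smul, Real.norm_eq_abs, abs_of_nonneg (mul_nonneg zero_le_two hE0)]
    · rw [norm_smul, Real.norm_eq_abs, abs_two]
      exact mul_le_mul_of_nonneg_left hP zero_le_two
    · rw [norm_smul, Real.norm_eq_abs,
        abs_of_nonneg (mul_nonneg (mul_nonneg zero_le_two hρ0) (sq_nonneg _))]
      nlinarith [mul_le_mul_of_nonneg_right hK (norm_nonneg u)]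
  rw [norm_smul, Real.norm_eq_abs, abs_two] at h2q
  linarith

end Core

/-! ## The registered stub -/

/-- **[KF-dom] Pointwise domination of the kinetic integrand** (registered stub
`stub_kineticIntegrand_le_dominators` of the line `hemisphere-affine-slaving`, crux
stmt-AtomisticToContinuum-9518): for a nonnegative kernel and every `θ : ℝ`,
`Σ_jk D_jk² + |q|² ≤ 2 Σ_jk ((N+1)⁻¹Σᵢφᵢ(v_{ij}v_{ik} − θδ_jk))² + 4|m̄|²(Ē/ρ̄)
  + ½ Σ_a ((N+1)⁻¹Σᵢφᵢ|vᵢ|²v_{ia})² + 50|m̄|²(Ē/ρ̄)²`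
(traceless projection is a Frobenius contraction, `m̄ = ρ̄ū`, weighted Cauchy–Schwarz
`ρ̄|ū|² ≤ 2Ē`, and the expansion of `|v − ū|²(v − ū)`). [folklore] -/
theorem stub_kineticIntegrand_le_dominators : ∀ (θ : ℝ) (φ : ℕ → T3 → ℝ) (N : ℕ) (z : Cfg N) (x : T3), (∀ y, 0 ≤ φ N y) → (∑ j : Fin 3, ∑ k : Fin 3, Dst φ N z x j k ^ 2) + ‖qfl φ N z x‖ ^ 2 ≤ 2 * (∑ j : Fin 3, ∑ k : Fin 3, (((N : ℝ) + 1)⁻¹ * ∑ i : Fin (N + 1), φ N ((z i).1 - x) * ((z i).2 j * (z i).2 k - if j = k then θ else 0)) ^ 2) + 4 * (‖mB φ N z x‖ ^ 2 * (EB φ N z x / rhoB φ N z x)) + 1 / 2 * (∑ a : Fin 3, (((N : ℝ) + 1)⁻¹ * ∑ i : Fin (N + 1), φ N ((z i).1 - x) * (‖(z i).2‖ ^ 2 * (z i).2 a)) ^ 2) + 50 * (‖mB φ N z x‖ ^ 2 * (EB φ N z x / rhoB φ N z x) ^ 2) := by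
  intro θ φ N z x hφ0
  have hcN : ((N + 1 : ℕ) : ℝ)⁻¹ = ((N : ℝ) + 1)⁻¹ := by rw [Nat.cast_succ]
  have hc0 : 0 ≤ ((N : ℝ) + 1)⁻¹ := by positivity
  have hρ0 : 0 ≤ rhoB φ N z x := rhoB_nonneg hφ0
  rcases hρ0.eq_or_lt with hρ | hρ
  · -- empty block: all weights vanish, the left-hand side is `0`
    have hρ' : rhoB φ N z x = 0 := hρ.symm
    have ha0 : ∀ i, φ N ((z i).1 - x) = 0 := by
      have h1 : ((N : ℝ) + 1)⁻¹ * ∑ i, φ N ((z i).1 - x) = 0 := by rw [← hρ', rhoB_eq, hcN]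
      have h2 : ∑ i, φ N ((z i).1 - x) = 0 :=
        (mul_eq_zero.1 h1).resolve_left (inv_ne_zero (by positivity))
      intro i
      exact (Finset.sum_eq_zero_iff_of_nonneg fun i _ => hφ0 ((z i).1 - x)).1 h2 i
        (Finset.mem_univ i)
    have hD : ∀ j k, Dst φ N z x j k = 0 := fun j k => by
      rw [Dst_eq]
      simp [ha0]
    have hq : qfl φ N z x = 0 := by
      rw [qfl_eq]
      simp [ha0]
    have hL : (∑ j : Fin 3, ∑ k : Fin 3, Dst φ N z x j k ^ 2) + ‖qfl φ N z x‖ ^ 2 = 0 := by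
      simp [hD, hq]
    rw [hL, hρ', div_zero]
    positivity
  · -- a block with `ρ̄ > 0`
    have hρeq : ((N : ℝ) + 1)⁻¹ * ∑ i, φ N ((z i).1 - x) = rhoB φ N z x := by
      rw [rhoB_eq, hcN]
    have hEeq : ((N : ℝ) + 1)⁻¹ * ∑ i, φ N ((z i).1 - x) * (‖(z i).2‖ ^ 2 / 2) = EB φ N z x := by
      rw [EB_eq, hcN]
    have hmu : mB φ N z x = rhoB φ N z x • uB φ N z x := by
      rw [uB, smul_smul, mul_inv_cancel₀ hρ.ne', one_smul]
    have hmvec : ((N : ℝ) + 1)⁻¹ • ∑ i, φ N ((z i).1 - x) • (z i).2 =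
        rhoB φ N z x • uB φ N z x := by
      rw [← hcN, ← mB_eq]
      exact hmu
    have hm : ∀ j, ((N : ℝ) + 1)⁻¹ * ∑ i, φ N ((z i).1 - x) * (z i).2 j =
        rhoB φ N z x * uB φ N z x j := fun j => by
      simpa only [PiLp.smul_apply, WithLp.ofLp_sum, Finset.sum_apply, smul_eq_mul] using
        congrArg (fun w : V3 => w j) hmvec
    have hK : rhoB φ N z x * ‖uB φ N z x‖ ^ 2 ≤ 2 * EB φ N z x := by
      have h := norm_uB_sq_le (w := z) (x := x) hφ0 hρ
      rw [le_div_iff₀ hρ] at h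
      linarith
    have hnm : ‖mB φ N z x‖ = rhoB φ N z x * ‖uB φ N z x‖ := by
      rw [hmu, norm_smul, Real.norm_eq_abs, abs_of_pos hρ]
    -- stress
    have hS : ∑ j : Fin 3, ∑ k : Fin 3, Dst φ N z x j k ^ 2 ≤
        2 * (∑ j : Fin 3, ∑ k : Fin 3, (((N : ℝ) + 1)⁻¹ * ∑ i : Fin (N + 1),
          φ N ((z i).1 - x) * ((z i).2 j * (z i).2 k - if j = k then θ else 0)) ^ 2) +
          2 * (rhoB φ N z x ^ 2 * (‖uB φ N z x‖ ^ 2) ^ 2) := by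
      simp only [Dst_eq, hcN]
      exact sum_sq_traceless_central_le ((N : ℝ) + 1)⁻¹ θ (rhoB φ N z x)
        (fun i => φ N ((z i).1 - x)) (fun i => (z i).2) (uB φ N z x) hρeq hm
    have hS' : 2 * (rhoB φ N z x ^ 2 * (‖uB φ N z x‖ ^ 2) ^ 2) ≤
        4 * (‖mB φ N z x‖ ^ 2 * (EB φ N z x / rhoB φ N z x)) := by
      have h1 : ‖mB φ N z x‖ ^ 2 * (EB φ N z x / rhoB φ N z x) =
          rhoB φ N z x * ‖uB φ N z x‖ ^ 2 * EB φ N z x := by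
        rw [hnm]
        field_simp
      rw [h1]
      nlinarith [mul_nonneg (mul_nonneg hρ.le (sq_nonneg ‖uB φ N z x‖)) (sub_nonneg.2 hK)]
    -- heat flux
    have hQ : ‖qfl φ N z x‖ ≤
        ‖((N : ℝ) + 1)⁻¹ • ∑ i, φ N ((z i).1 - x) • (‖(z i).2‖ ^ 2 • (z i).2)‖ / 2 +
          5 * EB φ N z x * ‖uB φ N z x‖ := by
      rw [qfl_eq, hcN]
      exact norm_heatFlux_le ((N : ℝ) + 1)⁻¹ (rhoB φ N z x) (EB φ N z x)
        (fun i => φ N ((z i).1 - x)) (fun i => (z i).2) (uB φ N z x) hc0 (fun i => hφ0 _)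
        hρeq hEeq hm hK
    have hT : ‖((N : ℝ) + 1)⁻¹ • ∑ i, φ N ((z i).1 - x) • (‖(z i).2‖ ^ 2 • (z i).2)‖ ^ 2 =
        ∑ a : Fin 3, (((N : ℝ) + 1)⁻¹ * ∑ i : Fin (N + 1),
          φ N ((z i).1 - x) * (‖(z i).2‖ ^ 2 * (z i).2 a)) ^ 2 := by
      rw [EuclideanSpace.real_norm_sq_eq]
      simp only [PiLp.smul_apply, WithLp.ofLp_sum, Finset.sum_apply, smul_eq_mul]
    have hY : ‖mB φ N z x‖ ^ 2 * (EB φ N z x / rhoB φ N z x) ^ 2 =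
        (EB φ N z x * ‖uB φ N z x‖) ^ 2 := by
      rw [hnm]
      field_simp
    have hQ' : ‖qfl φ N z x‖ ^ 2 ≤
        1 / 2 * (∑ a : Fin 3, (((N : ℝ) + 1)⁻¹ * ∑ i : Fin (N + 1),
          φ N ((z i).1 - x) * (‖(z i).2‖ ^ 2 * (z i).2 a)) ^ 2) +
          50 * (‖mB φ N z x‖ ^ 2 * (EB φ N z x / rhoB φ N z x) ^ 2) := by
      rw [hY, ← hT]
      calc ‖qfl φ N z x‖ ^ 2
          ≤ (‖((N : ℝ) + 1)⁻¹ • ∑ i, φ N ((z i).1 - x) • (‖(z i).2‖ ^ 2 • (z i).2)‖ / 2 +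
              5 * EB φ N z x * ‖uB φ N z x‖) ^ 2 := pow_le_pow_left₀ (norm_nonneg _) hQ 2
        _ ≤ _ := by
            nlinarith [sq_nonneg (‖((N : ℝ) + 1)⁻¹ • ∑ i, φ N ((z i).1 - x) •
              (‖(z i).2‖ ^ 2 • (z i).2)‖ / 2 - 5 * EB φ N z x * ‖uB φ N z x‖)]
    linarith [hS, hS', hQ']

end

end Summit.AtomisticToContinuum.HydrodynamicLimit.Theorems.HemisphereAffineSlaving
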